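import Summits.AtomisticToContinuum.BoseEinsteinCondensation.Theses.BECConjugateDomination
import Summits.AtomisticToContinuum.BoseEinsteinCondensation.Theorems.BECConjugateDominationPositiveMinimiserRegularity
import Summits.AtomisticToContinuum.BoseEinsteinCondensation.Theorems.BECConjugateDominationPositiveMinimiserTorusGS2
import Literature.MathematicalPhysics.QuantumManyBody.PeriodicBoseGasJastrow

/-!
# Route `BECConjugateDomination` — crux `PuffFloor` (stmt-AtomisticToContinuum-11785), line
# `coupling-slope-pocket`, stub `stub_positiveMinimiser` (= support item `PositiveMinimiser`,
# stmt-AtomisticToContinuum-11787)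

For every smooth-class pair potential `v` (repulsive, finite range `R₀`, finite, `C²` as
`ṽ(x) = v(|x|)` on `ℝ³`; the edge condition is not used), every `N = n + 1` and every `L > 0`, the
periodic `N`-body energy `periodicEnergy v` has an EXACT minimiser in the `C¹` periodic Bose class
`PeriodicTrialState (n+1) L` which is `C³`, of finite energy, real and pointwise strictly positive.

## Proof (assembly of the tree's torus Feynman–Kac theory)

* §1 **The periodised interaction of a smooth-class profile, for EVERY `L > 0`** (no nearest-image
  restriction `2R₀ < L`, unlike `PeriodizedPotentialNearestImage.lean`). Near every point of `ℝ³` only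
  the finitely many lattice images `n ∈ ℤ³` with `‖x₀ - Ln‖ ≤ R₀ + 1` are seen
  (`finite_setOf_norm_sub_latticeVec_le`, `periodizedPotential_eventuallyEq_sum`), so
  `x ↦ v^per(x)` is finite and, read in `ℝ`, `C²` (`contDiff_toReal_periodizedPotential_locFinite`); hence the
  real interaction `W = (∑_{i<j} v^per(xᵢ - xⱼ)).toReal` is `C²` on `(ℝ³)^N`
  (`contDiff_toReal_periodicInteraction_locFinite`), `Lℤ³`-periodic in every particle, Lipschitz (its
  derivative is continuous and periodic, hence bounded: `exists_lipschitz_of_periodic`), and `v^per`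
  is bounded (`exists_periodizedPotential_le`: continuous and lattice periodic, `single_eq_latticeVec`).
* **The ground state.** For a measurable pair potential with bounded periodisation the torus
  Feynman–Kac ground state exists: a continuous, strictly positive, periodic, Bose-symmetric,
  cell-normalised `Ψ₀` with `e^{-tH}Ψ₀ = e^{-λt}Ψ₀` pointwise and
  `periodicGroundStateEnergy v N L = λ` (`PositiveMinimiser.exists_torus_groundState`,
  Perron–Frobenius for the compact positivity-improving semigroup on `L²(cell)`, Reed–Simon IV
  Thm XIII.44, and the variational identification, Chung–Zhao Thm 3.27 / Prop 3.29).
* **Regularity.** `Ψ₀ ∈ C³` by the free-heat Duhamel bootstrap of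
  `PositiveMinimiser.contDiff_of_eigen` (`Ψ₀ = P_1Ψ₀ - ∫₀¹ P_s((W - λ)Ψ₀) ds`, each application of the
  Gaussian semigroup gaining one derivative; `W ∈ C²` gives `C³`).
* §2 **The energy identity.** For the now `C¹` eigenfunction the Fatou bound of the tree,
  `∫_cell |∇Ψ₀|² ≤ liminf_{t→0⁺} sqIncrCell(t)/(2t) ≤ λ - ∫_cell W Ψ₀²`
  (`kinetic_le_liminf_sqIncrCell`, `sqIncrCell_div_eventually_le`), gives
  `periodicEnergy ≤ λ = periodicGroundStateEnergy`, and the variational principle gives equality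
  (`periodicEnergy_eq_of_eigen`).
* The trial state is `X ↦ (Ψ₀ X : ℂ)`: `C³`, periodic, symmetric, normalised, real (`Ψ = |Ψ|`) and
  nowhere zero.

References: [ReedSimonIV1978] §XIII.12, Thms XIII.43–47; [LSSY2005] Ch. 2 (the nonnegative
normalised ground state); Chung–Zhao (1995) Thms 3.17, 3.27, Prop 3.29.
-/

noncomputable section

namespace Summit.AtomisticToContinuum.BoseEinsteinCondensation.Theorems

open MeasureTheory Filter Set Metric
open scoped ENNReal NNReal BigOperators Topology
open Literature.MathematicalPhysics.QuantumManyBody.BoseGas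
open Summit.AtomisticToContinuum.BoseEinsteinCondensation.Theses.BECConjugateDomination
open Summit.AtomisticToContinuum.BoseEinsteinCondensation.Theorems.PositiveMinimiser

namespace PositiveMinimiserStub

/-! ### §1 The periodisation of a smooth finite-range profile -/

/-- The lattice points `n ∈ ℤ³` with `‖x - L n‖ ≤ ρ` form a finite set (`L ≠ 0`). [folklore] -/
theorem finite_setOf_norm_sub_latticeVec_le {L : ℝ} (hL : L ≠ 0) (x : Space) (ρ : ℝ) :
    {n : Fin 3 → ℤ | ‖x - latticeVec L n‖ ≤ ρ}.Finite := by
  set B : ℝ := (‖x‖ + ρ) / |L| with hB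
  refine (Finset.finite_toSet (Finset.Icc (fun _ : Fin 3 => -⌈B⌉) (fun _ => ⌈B⌉))).subset ?_
  intro n hn
  simp only [Set.mem_setOf_eq] at hn
  rw [Finset.coe_Icc, Set.mem_Icc]
  have hk : ∀ k, |(n k : ℝ)| ≤ B := by
    intro k
    have h1 : ‖latticeVec L n k‖ ≤ ‖latticeVec L n‖ := PiLp.norm_apply_le (latticeVec L n) k
    have h2 : ‖latticeVec L n‖ ≤ ‖x‖ + ρ := by
      have := norm_sub_le x (x - latticeVec L n)
      rw [sub_sub_cancel] at this
      linarith
    have h3 : latticeVec L n k = L * n k := rfl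
    rw [h3, Real.norm_eq_abs, abs_mul] at h1
    rw [hB, le_div_iff₀ (abs_pos.2 hL)]
    linarith
  constructor
  · intro k
    have := (abs_le.1 (hk k)).1
    have h' : (-(⌈B⌉ : ℝ)) ≤ n k := by linarith [Int.le_ceil B]
    exact_mod_cast h'
  · intro k
    have := (abs_le.1 (hk k)).2
    have h' : (n k : ℝ) ≤ (⌈B⌉ : ℝ) := this.trans (Int.le_ceil B)
    exact_mod_cast h'

/-- **Local finiteness of the periodisation**: near every point, only finitely many lattice
images of a finite-range profile are seen. [folklore] -/
theorem eventually_forall_not_mem_eq_zero {v : ℝ → ℝ≥0∞} {R₀ L : ℝ} (hR : ∀ r, R₀ < r → v r = 0)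
    (hL : L ≠ 0) (x₀ : Space) :
    ∃ S : Finset (Fin 3 → ℤ), ∀ᶠ x in 𝓝 x₀, ∀ n ∉ S, v ‖x - latticeVec L n‖ = 0 := by
  refine ⟨(finite_setOf_norm_sub_latticeVec_le hL x₀ (R₀ + 1)).toFinset, ?_⟩
  filter_upwards [Metric.ball_mem_nhds x₀ one_pos] with x hx n hn
  apply hR
  rw [Set.Finite.mem_toFinset, Set.mem_setOf_eq, not_le] at hn
  rw [Metric.mem_ball, dist_eq_norm] at hx
  have := norm_sub_le_norm_sub_add_norm_sub x₀ x (latticeVec L n)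
  rw [norm_sub_rev x₀ x] at this
  linarith

/-- Near every point the periodisation is a FINITE sum of lattice translates. [folklore] -/
theorem periodizedPotential_eventuallyEq_sum {v : ℝ → ℝ≥0∞} {R₀ L : ℝ} (hR : ∀ r, R₀ < r → v r = 0)
    (hL : L ≠ 0) (x₀ : Space) :
    ∃ S : Finset (Fin 3 → ℤ), ∀ᶠ x in 𝓝 x₀,
      periodizedPotential v L x = ∑ n ∈ S, v ‖x - latticeVec L n‖ := by
  obtain ⟨S, hS⟩ := eventually_forall_not_mem_eq_zero hR hL x₀
  refine ⟨S, ?_⟩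
  filter_upwards [hS] with x hx
  exact tsum_eq_sum hx

/-- The periodisation of a finite, finite-range profile is finite everywhere. [folklore] -/
theorem periodizedPotential_ne_top_of_finiteRange {v : ℝ → ℝ≥0∞} {R₀ L : ℝ} (hfin : ∀ r, v r ≠ ⊤)
    (hR : ∀ r, R₀ < r → v r = 0) (hL : L ≠ 0) (x : Space) : periodizedPotential v L x ≠ ⊤ := by
  obtain ⟨S, hS⟩ := periodizedPotential_eventuallyEq_sum hR hL x
  rw [hS.self_of_nhds]
  exact ENNReal.sum_ne_top.2 fun n _ => hfin _

/-- **The periodisation of a `C^k` finite-range profile is `C^k`** (as the real function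
`x ↦ (v^per(x)).toReal` on `ℝ³`): locally it is a finite sum of translates. [folklore] -/
theorem contDiff_toReal_periodizedPotential_locFinite {v : ℝ → ℝ≥0∞} {R₀ L : ℝ} {k : ℕ∞}
    (hfin : ∀ r, v r ≠ ⊤) (hR : ∀ r, R₀ < r → v r = 0) (hL : L ≠ 0)
    (hv : ContDiff ℝ k fun x : Space => (v ‖x‖).toReal) :
    ContDiff ℝ k fun x : Space => (periodizedPotential v L x).toReal := by
  refine contDiff_iff_contDiffAt.2 fun x₀ => ?_
  obtain ⟨S, hS⟩ := periodizedPotential_eventuallyEq_sum hR hL x₀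
  have heq : (fun x => (periodizedPotential v L x).toReal) =ᶠ[𝓝 x₀]
      fun x => ∑ n ∈ S, (v ‖x - latticeVec L n‖).toReal := by
    filter_upwards [hS] with x hx
    rw [hx, ENNReal.toReal_sum fun n _ => hfin _]
  refine ContDiffAt.congr_of_eventuallyEq ?_ heq
  exact ContDiffAt.sum fun n _ => (hv.comp (contDiff_id.sub contDiff_const)).contDiffAt

/-- **The real periodic interaction `W = (∑_{i<j} v^per(xᵢ - xⱼ)).toReal` is `C^k`** for a `C^k`
finite, finite-range profile. [folklore] -/
theorem contDiff_toReal_periodicInteraction_locFinite {N : ℕ} {v : ℝ → ℝ≥0∞} {R₀ L : ℝ} {k : ℕ∞}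
    (hfin : ∀ r, v r ≠ ⊤) (hR : ∀ r, R₀ < r → v r = 0) (hL : L ≠ 0)
    (hv : ContDiff ℝ k fun x : Space => (v ‖x‖).toReal) :
    ContDiff ℝ k fun X : Config N => (periodicInteraction v L X).toReal := by
  have hV := contDiff_toReal_periodizedPotential_locFinite hfin hR hL hv
  have hne : ∀ y, periodizedPotential v L y ≠ ⊤ := periodizedPotential_ne_top_of_finiteRange hfin hR hL
  have heq : (fun X : Config N => (periodicInteraction v L X).toReal) = fun X =>
      ∑ i, ∑ j ∈ Finset.univ.filter (fun j => i < j), (periodizedPotential v L (X i - X j)).toReal := by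
    funext X
    unfold periodicInteraction
    rw [ENNReal.toReal_sum fun i _ => ENNReal.sum_ne_top.2 fun j _ => hne _]
    exact Finset.sum_congr rfl fun i _ => ENNReal.toReal_sum fun j _ => hne _
  rw [heq]
  refine ContDiff.sum fun i _ => ContDiff.sum fun j _ => hV.comp ?_
  exact (contDiff_apply ℝ Space i).sub (contDiff_apply ℝ Space j)

/-- **The periodisation of a continuous finite, finite-range profile is bounded**
(continuous and `Lℤ³`-periodic, `L > 0`). [folklore] -/
theorem exists_periodizedPotential_le {v : ℝ → ℝ≥0∞} {R₀ L : ℝ} (hfin : ∀ r, v r ≠ ⊤)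
    (hR : ∀ r, R₀ < r → v r = 0) (hL : 0 < L)
    (hv : Continuous fun x : Space => (v ‖x‖).toReal) :
    ∃ C : ℝ≥0, ∀ x, periodizedPotential v L x ≤ C := by
  have hV : Continuous fun x : Space => (periodizedPotential v L x).toReal :=
    (contDiff_toReal_periodizedPotential_locFinite (k := 0) hfin hR hL.ne' (contDiff_zero.2 hv)).continuous
  -- read through a one-particle configuration to use the tree's periodic bound
  set ψ : Config 1 → ℝ := fun X => (periodizedPotential v L (X 0)).toReal with hψ
  have hψc : Continuous ψ := hV.comp (continuous_apply 0)
  have hψper : ∀ (X : Config 1) (i : Fin 1) (k : Fin 3),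
      ψ (X + Pi.single i (EuclideanSpace.single k L)) = ψ X := by
    intro X i k
    have hi : i = 0 := Subsingleton.elim _ _
    subst hi
    simp only [hψ, Pi.add_apply, Pi.single_eq_same]
    rw [single_eq_latticeVec, periodizedPotential_add_latticeVec]
  obtain ⟨M, hM0, hM⟩ := exists_bound_of_continuous_periodic hL hψc hψper
  refine ⟨M.toNNReal, fun x => ?_⟩
  have h1 := hM (fun _ => x)
  simp only [hψ] at h1
  change periodizedPotential v L x ≤ ENNReal.ofReal M
  rw [← ENNReal.ofReal_toReal (periodizedPotential_ne_top_of_finiteRange hfin hR hL.ne' x)]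
  exact ENNReal.ofReal_le_ofReal ((le_abs_self _).trans h1)

/-- **A periodic `C¹` function on configuration space is Lipschitz** (its derivative is continuous
and periodic, hence bounded; mean value inequality). [folklore] -/
theorem exists_lipschitz_of_periodic {N : ℕ} {L : ℝ} (hL : 0 < L) {W : Config N → ℝ}
    (hW : ContDiff ℝ 1 W)
    (hper : ∀ (X : Config N) (i : Fin N) (k : Fin 3),
      W (X + Pi.single i (EuclideanSpace.single k L)) = W X) :
    ∃ G : ℝ, 0 ≤ G ∧ ∀ Y Z : Config N, |W Y - W Z| ≤ G * ‖Y - Z‖ := by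
  obtain ⟨G, hG0, hG⟩ := exists_bound_of_continuous_periodicE hL (hW.continuous_fderiv one_ne_zero)
    (fderiv_periodicE hper)
  refine ⟨G, hG0, fun Y Z => ?_⟩
  rw [← Real.norm_eq_abs]
  exact Convex.norm_image_sub_le_of_norm_fderiv_le (fun X _ => hW.differentiable one_ne_zero X)
    (fun X _ => hG X) convex_univ (Set.mem_univ Z) (Set.mem_univ Y)

/-! ### §2 The energy of a `C¹` Feynman–Kac eigenfunction -/

/-- **A `C¹` periodic Feynman–Kac eigenfunction is an exact minimiser.** If `Ψ₀ ≥ 0` is `C¹`,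
periodic, cell-normalised, satisfies `e^{-tH}Ψ₀ = e^{-λt}Ψ₀` pointwise and
`periodicGroundStateEnergy = λ`, then the periodic trial state with wave function `Ψ₀` has energy
`λ`: the Fatou bound `∫_cell|∇Ψ₀|² ≤ liminf sqIncrCell/(2t) ≤ λ - ∫_cell V^perΨ₀²` of the tree
closes the variational inequality. [folklore] -/
theorem periodicEnergy_eq_of_eigen {N : ℕ} {v : ℝ → ℝ≥0∞} (hv : Measurable v) {L : ℝ} (hL : 0 < L)
    {C : ℝ≥0} (hC : ∀ x, periodizedPotential v L x ≤ C) {Ψ₀ : Config N → ℝ} (hC1 : ContDiff ℝ 1 Ψ₀)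
    (hper : ∀ (X : Config N) (i : Fin N) (k : Fin 3),
      Ψ₀ (X + Pi.single i (EuclideanSpace.single k L)) = Ψ₀ X)
    (hnn : ∀ X, 0 ≤ Ψ₀ X) (hnorm : ∫ X in cellN N L, Ψ₀ X ^ 2 = 1) {lam : ℝ}
    (heig : ∀ t : ℝ, 0 < t → ∀ X, pfkReal v L t Ψ₀ X = Real.exp (-(lam * t)) * Ψ₀ X)
    (hE : periodicGroundStateEnergy v N L = ENNReal.ofReal lam) (Ψ : PeriodicTrialState N L)
    (hΨ : Ψ.ψ = fun X => ((Ψ₀ X : ℝ) : ℂ)) :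
    periodicEnergy v Ψ = periodicGroundStateEnergy v N L := by
  have hcont : Continuous Ψ₀ := hC1.continuous
  obtain ⟨M, -, hM⟩ := exists_bound_of_continuous_periodic hL hcont hper
  have hsq : Integrable (fun X => Ψ₀ X ^ 2) (volume.restrict (cellN N L)) :=
    (memLp_two_cellN_of_bound L hcont.measurable hM).integrable_sq
  -- the integrated eigen-relation
  have heig' : ∀ t : ℝ, 0 < t → Real.exp (-(lam * t)) ≤ ∫ X in cellN N L, Ψ₀ X * pfkReal v L t Ψ₀ X := by
    intro t ht
    have : (fun X => Ψ₀ X * pfkReal v L t Ψ₀ X) = fun X => Real.exp (-(lam * t)) * Ψ₀ X ^ 2 := by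
      funext X; rw [heig t ht X]; ring
    rw [this, integral_const_mul, hnorm, mul_one]
  set Pot : ℝ := ∫ X in cellN N L, Ψ₀ X ^ 2 * (periodicInteraction v L X).toReal with hPot
  have hPot0 : 0 ≤ Pot := integral_nonneg fun X => mul_nonneg (sq_nonneg _) ENNReal.toReal_nonneg
  have hPotle : Pot ≤ lam :=
    setIntegral_cellN_sq_mul_periodicInteraction_le hv hL hC hcont hper hnn hnorm heig'
  -- Fatou: the kinetic energy of the `C¹` eigenfunction
  have hkin : ∫⁻ X in cellN N L, realKinetic Ψ₀ X ≤ ENNReal.ofReal (lam - Pot) := by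
    refine ENNReal.le_of_forall_pos_le_add fun ε hε _ => ?_
    have hK' : lam - Pot < lam - Pot + ε := lt_add_of_pos_right _ (by exact_mod_cast hε)
    have hev := sqIncrCell_div_eventually_le hv hL hC hcont hper hnn hnorm heig' hK'
    calc ∫⁻ X in cellN N L, realKinetic Ψ₀ X
        ≤ liminf (fun t : ℝ≥0 => (ENNReal.ofReal (2 * t))⁻¹ * sqIncrCell L t Ψ₀) (𝓝[>] 0) :=
          kinetic_le_liminf_sqIncrCell L hC1
      _ ≤ liminf (fun _ : ℝ≥0 => ENNReal.ofReal (lam - Pot + ε)) (𝓝[>] 0) := liminf_le_liminf hev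
      _ = ENNReal.ofReal (lam - Pot + ε) := liminf_const _
      _ ≤ ENNReal.ofReal (lam - Pot) + ε := by
          rw [ENNReal.ofReal_add (by linarith) ε.coe_nonneg, ENNReal.ofReal_coe_nnreal]
  have hΨ' : Ψ.ψ = fun X => (((1 * Ψ₀ X : ℝ)) : ℂ) := by rw [hΨ]; simp
  have hpotE := setLIntegral_cellN_sq_mul_periodicInteraction_eq_ofReal hv hC hcont.measurable hsq
  refine le_antisymm ?_ (periodicGroundStateEnergy_le v Ψ)
  rw [periodicEnergy_of_ofReal_mul Ψ hC1 hΨ' v, one_pow, ENNReal.ofReal_one, one_mul, hpotE, hE]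
  calc (∫⁻ X in cellN N L, realKinetic Ψ₀ X) + ENNReal.ofReal Pot
      ≤ ENNReal.ofReal (lam - Pot) + ENNReal.ofReal Pot := add_le_add hkin le_rfl
    _ = ENNReal.ofReal lam := by rw [← ENNReal.ofReal_add (by linarith) hPot0, sub_add_cancel]

end PositiveMinimiserStub

open PositiveMinimiserStub in
/-- **S5 `stub_positiveMinimiser` = support item `PositiveMinimiser` (stmt-AtomisticToContinuum-11787).**
For every smooth-class `v` (repulsive finite range, finite, `C²` as `ṽ(x) = v(|x|)`; the edge
condition is carried but unused), every `n` and every `L > 0`, the periodic `(n+1)`-body energy has a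
minimiser in the `C¹` periodic Bose class which is `C³`, has finite energy, and is pointwise
strictly positive (`Ψ = |Ψ| ≠ 0`): the torus Feynman–Kac ground state (Perron–Frobenius on
`L²(cell)`), made `C³` by the free-heat Duhamel bootstrap for the `C²` periodised interaction, is an
exact minimiser by the Fatou energy bound. Reed–Simon IV §XIII.12 (Thms XIII.43–47); LSSY2005 Ch. 2.
[cite: ReedSimonIV1978, §XIII.12 Thms XIII.44 and XIII.47] -/
theorem stub_positiveMinimiser : PositiveMinimiser := by
  intro v hv hfin hC2 _hedge n L hL
  obtain ⟨R₀, hR₀⟩ := hv.2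
  have hvm : Measurable v := hv.1
  -- §1: bounded periodisation; the real interaction is `C²`, periodic and Lipschitz
  obtain ⟨C, hC⟩ := exists_periodizedPotential_le hfin hR₀ hL hC2.continuous
  have hW2 : ContDiff ℝ 2 (fun X : Config (n + 1) => (periodicInteraction v L X).toReal) :=
    contDiff_toReal_periodicInteraction_locFinite hfin hR₀ hL.ne' hC2
  have hWper : ∀ (X : Config (n + 1)) (i : Fin (n + 1)) (c : Fin 3),
      (periodicInteraction v L (X + Pi.single i (EuclideanSpace.single c L))).toReal =
        (periodicInteraction v L X).toReal := fun X i c => by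
    rw [periodicInteraction_add_single]
  obtain ⟨G, hG0, hlip⟩ := exists_lipschitz_of_periodic hL (hW2.of_le one_le_two) hWper
  -- the torus Feynman–Kac ground state
  obtain ⟨Ψ₀, lam, -, hcont, hpos, hper, hsymm, hnormL, hnormR, heig, hE⟩ :=
    exists_torus_groundState (N := n + 1) hvm hL hC
  -- regularity: `W ∈ C²` ⇒ `Ψ₀ ∈ C³`
  have hC3 : ContDiff ℝ 3 Ψ₀ := by
    have h := contDiff_of_eigen hvm hL hC hG0 hlip (k := 2) hW2 hWper hcont hper heig
    exact_mod_cast h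
  have hC1 : ContDiff ℝ 1 Ψ₀ := hC3.of_le (by norm_num)
  -- the trial state `X ↦ (Ψ₀ X : ℂ)`
  have hnormΨ : ∫⁻ X in cellN (n + 1) L, ((‖((Ψ₀ X : ℝ) : ℂ)‖₊ : ℝ≥0∞)) ^ 2 = 1 := by
    have h1 : ∀ X, ((‖((Ψ₀ X : ℝ) : ℂ)‖₊ : ℝ≥0∞)) ^ 2 = ENNReal.ofReal (Ψ₀ X) ^ 2 := fun X => by
      rw [ennnorm_sq_ofReal_periodic, ENNReal.ofReal_pow (hpos X).le]
    simp_rw [h1]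
    exact hnormL
  let Ψ : PeriodicTrialState (n + 1) L :=
    { ψ := fun X => ((Ψ₀ X : ℝ) : ℂ)
      contDiff := Complex.ofRealCLM.contDiff.comp hC1
      periodic := fun X i k => by
        show ((Ψ₀ (X + Pi.single i (EuclideanSpace.single k L)) : ℝ) : ℂ) = ((Ψ₀ X : ℝ) : ℂ)
        rw [hper]
      symm := fun σ X => by
        show ((Ψ₀ (X ∘ σ) : ℝ) : ℂ) = ((Ψ₀ X : ℝ) : ℂ)
        rw [hsymm]
      norm_eq := hnormΨ }
  -- §2: the energy identity
  have hEΨ : periodicEnergy v Ψ = periodicGroundStateEnergy v (n + 1) L :=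
    periodicEnergy_eq_of_eigen hvm hL hC hC1 hper (fun X => (hpos X).le) hnormR heig hE Ψ rfl
  refine ⟨Ψ, hEΨ, ?_, Complex.ofRealCLM.contDiff.comp hC3, fun X => ?_, fun X => ?_⟩
  · rw [hEΨ, hE]
    exact ENNReal.ofReal_ne_top
  · show ((Ψ₀ X : ℝ) : ℂ) = ((‖((Ψ₀ X : ℝ) : ℂ)‖ : ℝ) : ℂ)
    rw [Complex.norm_real, Real.norm_of_nonneg (hpos X).le]
  · show ((Ψ₀ X : ℝ) : ℂ) ≠ 0
    exact_mod_cast (hpos X).ne'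

end Summit.AtomisticToContinuum.BoseEinsteinCondensation.Theorems

end
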